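/-
Copyright (c) 2026 the pub-hodgecm-mathlib formalisation cell (harness21).  Prover seat hodgecm-mathlib-LH4-p11 (g5), req620 Track A «(D-RAM) FOUR-FRAME» squad
(unit U2H_HSide, the (ρ2b′-X) road :418; payer by lineage LH4-p14 (g4) 2026-09-04T05:45:41Z «(C0b-2) (C1) ×2 application»; dealer LH4-plan (g12) WORD #26∕#28).
-/
import Summits.HodgeConjecture.HodgeConjecture.Theorems.F0P3cDyRamBlockCensusOrderForm            -- ★ p857559 (this seat): (C1) `ncard_fixed_selfDual_endoGL_eq_orderForm`
import Summits.HodgeConjecture.HodgeConjecture.Theorems.F0P3cDyRamFixedPointCensusTypeTwoPrelude    -- ★ p857439 (LH4-p14): `setOf_typeZero_fixed_eq_setOf_isSelfDualLattice_block`; brings :418's tokens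
import Literature.NumberTheory.Automorphic.UnitaryLatticeTreeFormTransport                        -- ★ `ncard_selfDual_fixed_sep_eq_of_formCongr` (count transport along `M ↦ P·M`)
import Literature.NumberTheory.Automorphic.UnitaryGroupFormTransport                              -- ★ `conj_mem_unitaryGroupOfForm_iff` (`PgP⁻¹ ∈ U(H) ↔ g ∈ U(ᵗσP H P)`)
import Literature.NumberTheory.Rogawski1990.UnitaryVertexStabilizerCoverCM                        -- ★ `isPrincipalIdealRing_integer_adicCompletion`, `galAdicCompletionMap_involutive`, `placeForm_map_transpose_of_hermitian`, `isUnit_det_placeForm`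
import Literature.NumberTheory.Automorphic.LocalUnitaryGroupCongr                                 -- ★ `antidiagOne_isHermitian`, `isUnit_antidiagOne_det`
import HarnessLib

/-!
# Crux `H413`, line LH4 «(D-RAM) FOUR-FRAME» — the (ρ2b′-X) road, brick (C0b-2) part 1: THE BLOCK CENSUS (C1) AT THE CM PLACE, IN THE TWO LITERAL SHAPES OF SOCKET (C″)
# `#{M ⊂ L_w³ ∣ M self-dual for Φ₃, ι_w(t)·M = M}` = (C1)'s order form, for `ι_w(t_h) = endoGL (γ₂, u)` (hyperbolic literal) and `ι_w(t_a) = P₁·endoGL (γ₁, u)·P₁⁻¹` with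
# `ᵗσ(P₁) Φ₃ P₁ = block(diag dg, η)` (anisotropic literal)

Cell `hodgecm-mathlib` (D-0151), FLOOR 0, crux item H413 = `stmt-HodgeConjecture-24833`, route of record `HCCMUnconditional`; squad F0∕P3c∕LH4; registered stub concerned:
`F0P3cDyRamFourFrameU2H.stub_U2H_fixedPointCensus_typeTwo_unit0` ((ρ2b′-X), U2H ED. 15 :418) through the payer lineage's socket chain (C) ⟸ (C′) ⟸ (C″) `SOCKET-hLM.v1` 66b80571
⟸ (C‴) (LH4-p14 (g4) MAP v2; (C0b-1) ★ p857694).  THEOREMS ONLY (no `def`, no instance, no notation, no `sorry`, default heartbeats); lane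
`--supports stmt-HodgeConjecture-24833 --as helper` (count-neutral).  No `tE`, no `t = 2`, no `d`.

WHAT IS PROVED.  The two `ncard` tokens of socket (C″)'s conclusion — `N t := #{M : Submodule 𝒪_w (L_w³) ∣ IsVertexLattice σ_w ϖ (antidiag₃) 0 M ∧ mapGL (ι_w t) M = M}` for the
hyperbolic literal `ι_w(t_h) = endoGL (γ₂, u)` and the anisotropic literal `ι_w(t_a) = P₁·endoGL (γ₁, u)·P₁⁻¹`, `formCongr σ_w P₁ (Φ₃)_w = !![diag dg …; 0, η, 0; …]` — ARE ★ (C1)'s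
order forms, under (C1)'s own antecedents (line model of the plane, `hfinF`, `hR`, `hJ`, `hfinLS`, weight `f` with `hf`, `hu`) instantiated at `E := L_w`, `σ := σ_w`,
`(H₂, h_W) := ((Φ₂)_w, 1)` resp. `(Matrix.diagonal dg, η)`; the line-model field `M`, `jE`, `ρ`, `Θ`, `α` stay ABSTRACT (the payer's `(E′_{w₁}, toPlace, c_{w₁}, Θ, α)`).
* §1 `ncard_typeZero_fixed_endoGL_eq_orderForm` — hyperbolic shape: ★ Prelude `setOf_typeZero_fixed_eq_setOf_isSelfDualLattice_block` (`Φ₃ = block(Φ₂, 1)` on the nose) ∘ ★ (C1),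
  with `(Φ₂)_w` hermitian of unit determinant (★ `placeForm_map_transpose_of_hermitian` ∘ ★ `antidiagOne_isHermitian`, ★ `isUnit_det_placeForm`) and `𝒪_w` a PID (★
  `isPrincipalIdealRing_integer_adicCompletion`).
* §2 `ncard_typeZero_fixed_conj_endoGL_eq_orderForm` — anisotropic shape: ★ `placeForm_antidiagThree_eq_over` ∘ ★ FormTransport `ncard_selfDual_fixed_sep_eq_of_formCongr` (`M ↦ P₁·M`,
  trivial labels) ∘ the frame equation ∘ ★ (C1) at `H₂ := Matrix.diagonal dg` (hermitian since `σ_w dg = dg`, unit determinant since `|dg i| = 1`), the block's unitarity from ★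
  `conj_mem_unitaryGroupOfForm_iff`.
Part 2 (the socket-level wrapper (C‴) ⟹ (C″)) follows the payer's word on the antecedent threading (bus 05:46:35Z).
HONEST LABEL.  Count-neutral; nothing printed is asserted; (ρ2b′-X) stays OPEN; `HC_CM` is proved only modulo the 7 printed citations (2 remaining named inputs: hLiu418 =
`stmt-HodgeConjecture-24832`, h413 = `stmt-HodgeConjecture-24833`) until rung 0 closes.

## References
* [Kottwitz1986BaseChangeUnits] R. E. Kottwitz, *Base change for unit elements of Hecke algebras*, Compositio Math. 60 (1986), §1 pp. 240–241.
* [Rogawski1990] J. D. Rogawski, *Automorphic Representations of Unitary Groups in Three Variables*, Ann. of Math. Stud. 123 (1990), §4.3 p. 43; §4.9 Prop. 4.9.1 (b) p. 55, Lemma 4.9.3 p. 56.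
* [Jacobowitz1962] R. Jacobowitz, *Hermitian forms over local fields*, Amer. J. Math. 84 (1962), §4.
* [PlatonovRapinchuk1994] V. Platonov, A. Rapinchuk, *Algebraic Groups and Number Theory* (1994), §5.1 (local forms at a place).
-/

set_option autoImplicit false

noncomputable section

namespace Summit.HodgeConjecture.HodgeConjecture.Cruxes.H413.F0P3cDyRamBlockCensusOrderFormCM

-- THE LINES MODULE'S `open` CONTEXT (tree `Cruxes/H413/Lines/F0_P3c_DyRamFourFrame_U2H_HSide.lean`, after its `namespace`):
open MeasureTheory Measure NumberField IsDedekindDomain Topology Filter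
open Literature.NumberTheory.Automorphic Literature.NumberTheory.Automorphic.UnitaryGroup Literature.NumberTheory.Automorphic.IntegralReduction
open Literature.NumberTheory.Rogawski1990 Literature.NumberTheory.GaloisRepresentations
open Literature.NumberTheory.Automorphic.UnitaryThreeFourFrame
open scoped Matrix MatrixGroups Classical Valued WithZero
open Literature.NumberTheory.Automorphic.UnitaryLatticeTree Literature.NumberTheory.Automorphic.HermitianLattice
open Literature.NumberTheory.Automorphic.EllipticPlaneAsFieldLine
open Literature.NumberTheory.LocalFields.QuadraticOrder
open Summit.HodgeConjecture.HodgeConjecture.Cruxes.H413.F0P3cDyRamToricCensusDefs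
open Summit.HodgeConjecture.HodgeConjecture.Cruxes.H413.F0P3cDyRamBlockCensusOrderForm
open Summit.HodgeConjecture.HodgeConjecture.Cruxes.H413.F0P3cDyRamFixedPointCensusTypeTwoPrelude

/-! ## §1 The hyperbolic literal: `ι_w(t_h) = endoGL (γ₂, u)` for `Φ₃ = block(Φ₂, 1)` -/

/-- **(C1) AT THE CM PLACE, HYPERBOLIC SHAPE.**  For `Γ = endoGL (γ₂, u) ∈ U(σ_w, (Φ₃)_w)` and a line model `(M, jE, ρ, Θ, α; φ, lam, h)` of the plane `((Φ₂)_w, γ₂)`, under ★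
(C1)'s antecedents: `#{M₃ ∣ IsVertexLattice σ_w ϖ (antidiag₃) 0 M₃ ∧ Γ·M₃ = M₃}` (socket (C″)'s `N t_h` token) `=` (C1)'s order form at `(H₂, h_W) := ((Φ₂)_w, 1)`.
[cite: Kottwitz1986BaseChangeUnits, §1 pp. 240–241] [cite: Rogawski1990, §4.3 p. 43; §4.9 Prop. 4.9.1 (b) p. 55] [cite: Jacobowitz1962, §4] -/
theorem ncard_typeZero_fixed_endoGL_eq_orderForm (L : Type) [Field L] [NumberField L] [IsCMField L]
    {v : HeightOneSpectrum (𝓞 ↥(maximalRealSubfield L))} (w : UnitaryGroup.PlacesOver L v)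
    (hw : IsCMField.complexConj L • w.1 = w.1) {ϖ : (w.1.adicCompletion L)} (hϖ : Valued.v ϖ = WithZero.exp (-1 : ℤ))
    {M : Type*} [Field M] [Valued M ℤᵐ⁰] {ρ Θ : M →+* M} {α : M} (jE : (w.1.adicCompletion L) →+* M)
    (hρρ : ∀ x, ρ (ρ x) = x) (hvρ : ∀ x, Valued.v (ρ x) = Valued.v x) (hα : ρ α ≠ α) (hα1 : Valued.v α ≤ 1)
    (hint : ∀ z : M, Valued.v z ≤ 1 → Valued.v ((z - ρ z) / (α - ρ α)) ≤ 1)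
    (hΘΘ : ∀ x, Θ (Θ x) = x) (hΘρ : ∀ x, Θ (ρ x) = ρ (Θ x)) (hvΘ : ∀ x, Valued.v (Θ x) = Valued.v x)
    (hΘj : ∀ x, Θ (jE x) = jE ((galAdicCompletionMap (L := L) (IsCMField.complexConj L) hw) x))
    (hjv : ∀ c, Valued.v (jE c) ≤ 1 ↔ Valued.v c ≤ 1) (hjfix : ∀ z, ρ z = z ↔ ∃ c, jE c = z)
    (hjpow : ∀ (t : (w.1.adicCompletion L)) (n : ℤ), Valued.v (jE t) = Valued.v (jE ϖ) ^ n ↔ Valued.v t = Valued.v ϖ ^ n)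
    (hEval : ∀ c : M, ρ c = c → c ≠ 0 → Valued.v c ≤ 1 → ∃ n : ℕ, Valued.v c = Valued.v (jE ϖ) ^ n)
    (hϖmax : ∀ t : M, ρ t = t → Valued.v t < 1 → Valued.v t ≤ Valued.v (jE ϖ))
    (φ : (Fin 2 → (w.1.adicCompletion L)) →+ M) (hφs : ∀ (c : (w.1.adicCompletion L)) (x : Fin 2 → (w.1.adicCompletion L)), φ (c • x) = jE c * φ x)
    (hφi : Function.Injective φ) (hφo : Function.Surjective φ)
    (γ₂ : GL (Fin 2) (w.1.adicCompletion L)) {lam h : M} (hφγ : ∀ x, φ ((γ₂ : Matrix (Fin 2) (Fin 2) (w.1.adicCompletion L)).mulVec x) = lam * φ x) (hlam : Valued.v lam = 1)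
    (hΘh : Θ h = h) (hh : h ≠ 0)
    (hform : ∀ x y, jE (pairing (galAdicCompletionMap (L := L) (IsCMField.complexConj L) hw) (placeForm (Matrix.of fun i j : Fin 2 => if i.val + j.val + 1 = 2 then (1 : L) else 0) w.1) x y) =
      h * Θ (φ x) * φ y + ρ (h * Θ (φ x) * φ y))
    (u : GL (Fin 1) (w.1.adicCompletion L))
    (hΓ : endoGL (γ₂, u) ∈ unitaryGroupOfForm (galAdicCompletionMap (L := L) (IsCMField.complexConj L) hw) (placeForm (Matrix.of fun i j : Fin 3 => if i.val + j.val + 1 = 3 then (1 : L) else 0) w.1))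
    (hu : Valued.v ((u : Matrix (Fin 1) (Fin 1) (w.1.adicCompletion L)) 0 0) = 1) {R : ℕ}
    (hfinF : {M₃ : Submodule (Valued.integer (w.1.adicCompletion L)) (Fin 3 → (w.1.adicCompletion L)) |
      IsVertexLattice (galAdicCompletionMap (L := L) (IsCMField.complexConj L) hw) ϖ ((StdForm.antidiagonal 3).over (w.1.adicCompletion L)) 0 M₃ ∧ mapGL (endoGL (γ₂, u)) M₃ = M₃}.Finite)
    (hR : ∀ M₃ : Submodule (Valued.integer (w.1.adicCompletion L)) (Fin 3 → (w.1.adicCompletion L)),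
      IsVertexLattice (galAdicCompletionMap (L := L) (IsCMField.complexConj L) hw) ϖ ((StdForm.antidiagonal 3).over (w.1.adicCompletion L)) 0 M₃ →
      mapGL (endoGL (γ₂, u)) M₃ = M₃ → ∀ b : ℕ, (∀ c : (w.1.adicCompletion L), (Pi.single 1 c : Fin 3 → (w.1.adicCompletion L)) ∈ M₃ ↔ Valued.v c ≤ Valued.v ϖ ^ b) → b ≤ R)
    {J : ℕ} (hJ : ¬ IsOrd ρ α (jE ϖ ^ (J + 1)) lam) (hfinLS : ∀ j a, (levelSet ρ Θ α (jE ϖ) h j a).Finite)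
    (f : ℕ → ℕ → AddSubgroup M → ℕ)
    (hf : ∀ (b j : ℕ) (Λ : AddSubgroup M) (x₀ : M) (r : (w.1.adicCompletion L)), 1 ≤ b → x₀ ≠ 0 →
      (∀ x, x ∈ Λ ↔ ∃ z, IsOrd ρ α (jE ϖ ^ j) z ∧ x = x₀ * z) →
      IsOrd ρ α (jE ϖ ^ j) (dualGen ρ Θ α (jE ϖ ^ j) h x₀) → ¬ IsOrd ρ α (jE ϖ ^ j) (dualGen ρ Θ α (jE ϖ ^ j) h x₀ / jE ϖ) →
      Valued.v (dualGen ρ Θ α (jE ϖ ^ j) h x₀) = Valued.v (jE ϖ) ^ b →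
      (∀ b', (∀ x ∈ Λ, Valued.v (h * Θ x * b' + ρ (h * Θ x * b')) ≤ 1) → (lam - jE ((u : Matrix (Fin 1) (Fin 1) (w.1.adicCompletion L)) 0 0)) * b' ∈ Λ) →
      IsOrd ρ α (jE ϖ ^ j) lam → jE r = glueUnit ρ Θ α (jE ϖ ^ j) h (jE ϖ) (jE 1) x₀ b →
      f b j Λ = Nat.card {x : 𝒪[(w.1.adicCompletion L)] ⧸ 𝓂[(w.1.adicCompletion L)] ^ (2 * b) //
        ∃ u' : 𝒪[(w.1.adicCompletion L)], Ideal.Quotient.mk (𝓂[(w.1.adicCompletion L)] ^ (2 * b)) u' = x ∧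
          Valued.v ((u' : (w.1.adicCompletion L)) * (galAdicCompletionMap (L := L) (IsCMField.complexConj L) hw) u' - r) ≤ Valued.v (ϖ ^ (2 * b))}) :
    {M₃ : Submodule (Valued.integer (w.1.adicCompletion L)) (Fin 3 → (w.1.adicCompletion L)) |
        IsVertexLattice (galAdicCompletionMap (L := L) (IsCMField.complexConj L) hw) ϖ ((StdForm.antidiagonal 3).over (w.1.adicCompletion L)) 0 M₃ ∧ mapGL (endoGL (γ₂, u)) M₃ = M₃}.ncard =
      (∑ j ∈ Finset.range (J + 1), (if IsOrd ρ α (jE ϖ ^ j) lam then (levelSet ρ Θ α (jE ϖ) h j 0).ncard else 0)) +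
        ∑ b ∈ Finset.Icc 1 R, ∑ j ∈ Finset.range (J + 1),
          (if IsOrd ρ α (jE ϖ ^ j) lam then ∑ᶠ Λ ∈ levelSetDep ρ Θ α (jE ϖ) h j b (lam - jE ((u : Matrix (Fin 1) (Fin 1) (w.1.adicCompletion L)) 0 0)), f b j Λ else 0) := by
  haveI : IsPrincipalIdealRing 𝒪[w.1.adicCompletion L] := isPrincipalIdealRing_integer_adicCompletion L v w
  have hσ : ∀ a, (galAdicCompletionMap (L := L) (IsCMField.complexConj L) hw) ((galAdicCompletionMap (L := L) (IsCMField.complexConj L) hw) a) = a :=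
    galAdicCompletionMap_involutive L v w hw
  have hvσ : ∀ a, Valued.v ((galAdicCompletionMap (L := L) (IsCMField.complexConj L) hw) a) = Valued.v a :=
    fun a => valued_galAdicCompletionMap (L := L) (IsCMField.complexConj L) hw a
  have hH₂ : IsUnit (placeForm (Matrix.of fun i j : Fin 2 => if i.val + j.val + 1 = 2 then (1 : L) else 0) w.1).det :=
    isUnit_det_placeForm L v w _ (isUnit_antidiagOne_det L 2).ne_zero
  have hH₂σ : ((placeForm (Matrix.of fun i j : Fin 2 => if i.val + j.val + 1 = 2 then (1 : L) else 0) w.1).map (galAdicCompletionMap (L := L) (IsCMField.complexConj L) hw))ᵀ =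
      placeForm (Matrix.of fun i j : Fin 2 => if i.val + j.val + 1 = 2 then (1 : L) else 0) w.1 :=
    placeForm_map_transpose_of_hermitian L v w hw _ (antidiagOne_isHermitian L 2)
  -- `Φ₃ = block(Φ₂, 1)` on the nose: the socket's set, the finiteness letters and the unitarity
  have hblock : placeForm (Matrix.of fun i j : Fin 3 => if i.val + j.val + 1 = 3 then (1 : L) else 0) w.1 =
      (!![(placeForm (Matrix.of fun i j : Fin 2 => if i.val + j.val + 1 = 2 then (1 : L) else 0) w.1) 0 0, 0,
          (placeForm (Matrix.of fun i j : Fin 2 => if i.val + j.val + 1 = 2 then (1 : L) else 0) w.1) 0 1;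
         0, (1 : w.1.adicCompletion L), 0;
         (placeForm (Matrix.of fun i j : Fin 2 => if i.val + j.val + 1 = 2 then (1 : L) else 0) w.1) 1 0, 0,
          (placeForm (Matrix.of fun i j : Fin 2 => if i.val + j.val + 1 = 2 then (1 : L) else 0) w.1) 1 1] : Matrix (Fin 3) (Fin 3) (w.1.adicCompletion L)) := by
    rw [placeForm_antidiagOne, placeForm_antidiagOne, antidiagonal_three_over_eq_block_antidiagonal_two]
  rw [setOf_typeZero_fixed_eq_setOf_isSelfDualLattice_block L w hw ϖ] at hfinF ⊢
  rw [hblock] at hΓ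
  have hR' : ∀ M₃ : Submodule (Valued.integer (w.1.adicCompletion L)) (Fin 3 → (w.1.adicCompletion L)),
      IsSelfDualLattice (galAdicCompletionMap (L := L) (IsCMField.complexConj L) hw) ϖ
        (!![(placeForm (Matrix.of fun i j : Fin 2 => if i.val + j.val + 1 = 2 then (1 : L) else 0) w.1) 0 0, 0,
            (placeForm (Matrix.of fun i j : Fin 2 => if i.val + j.val + 1 = 2 then (1 : L) else 0) w.1) 0 1;
           0, (1 : w.1.adicCompletion L), 0;
           (placeForm (Matrix.of fun i j : Fin 2 => if i.val + j.val + 1 = 2 then (1 : L) else 0) w.1) 1 0, 0,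
            (placeForm (Matrix.of fun i j : Fin 2 => if i.val + j.val + 1 = 2 then (1 : L) else 0) w.1) 1 1] : Matrix (Fin 3) (Fin 3) (w.1.adicCompletion L)) M₃ →
      mapGL (endoGL (γ₂, u)) M₃ = M₃ → ∀ b : ℕ, (∀ c : (w.1.adicCompletion L), (Pi.single 1 c : Fin 3 → (w.1.adicCompletion L)) ∈ M₃ ↔ Valued.v c ≤ Valued.v ϖ ^ b) → b ≤ R := by
    intro M₃ hM₃ hfix b hb
    have hmem : M₃ ∈ {M₃ : Submodule (Valued.integer (w.1.adicCompletion L)) (Fin 3 → (w.1.adicCompletion L)) |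
        IsSelfDualLattice (galAdicCompletionMap (L := L) (IsCMField.complexConj L) hw) ϖ
          (!![(placeForm (Matrix.of fun i j : Fin 2 => if i.val + j.val + 1 = 2 then (1 : L) else 0) w.1) 0 0, 0,
              (placeForm (Matrix.of fun i j : Fin 2 => if i.val + j.val + 1 = 2 then (1 : L) else 0) w.1) 0 1;
             0, (1 : w.1.adicCompletion L), 0;
             (placeForm (Matrix.of fun i j : Fin 2 => if i.val + j.val + 1 = 2 then (1 : L) else 0) w.1) 1 0, 0,
              (placeForm (Matrix.of fun i j : Fin 2 => if i.val + j.val + 1 = 2 then (1 : L) else 0) w.1) 1 1] : Matrix (Fin 3) (Fin 3) (w.1.adicCompletion L)) M₃ ∧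
        mapGL (endoGL (γ₂, u)) M₃ = M₃} := ⟨hM₃, hfix⟩
    rw [← setOf_typeZero_fixed_eq_setOf_isSelfDualLattice_block L w hw ϖ] at hmem
    exact hR M₃ hmem.1 hmem.2 b hb
  have hf' := hf
  simp only [map_one] at hf'
  have key := ncard_fixed_selfDual_endoGL_eq_orderForm (galAdicCompletionMap (L := L) (IsCMField.complexConj L) hw) hσ hvσ hϖ hH₂ hH₂σ
    (hW := (1 : w.1.adicCompletion L)) (by rw [map_one]) (map_one _) jE hρρ hvρ hα hα1 hint hΘΘ hΘρ hvΘ hΘj hjv hjfix hjpow hEval hϖmax φ hφs hφi hφo hφγ hlam hΘh hh hform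
    u hΓ hu hfinF hR' hJ hfinLS f (by simpa only [map_one] using hf')
  exact key

/-! ## §2 The anisotropic literal: `ι_w(t_a) = P₁·endoGL (γ₁, u)·P₁⁻¹` with `ᵗσ(P₁) Φ₃ P₁ = block(diag dg, η)` -/

/-- **(C1) AT THE CM PLACE, ANISOTROPIC SHAPE.**  For `P₁·endoGL (γ₁, u)·P₁⁻¹ ∈ U(σ_w, (Φ₃)_w)` with the frame equation `formCongr σ_w P₁ (Φ₃)_w = block(Matrix.diagonal dg, η)`
(`|dg i| = 1`, `σ_w dg = dg`, `|η| = 1`, `σ_w η = η` — socket (A′)'s letters) and a line model `(M, jE, ρ, Θ, α; φ, lam, h)` of the plane `(Matrix.diagonal dg, γ₁)`, under ★ (C1)'s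
antecedents: `#{M₃ ∣ IsVertexLattice σ_w ϖ (antidiag₃) 0 M₃ ∧ (P₁ΓP₁⁻¹)·M₃ = M₃}` (socket (C″)'s `N t_a` token) `=` (C1)'s order form at `(H₂, h_W) := (Matrix.diagonal dg, η)`, via ★
`ncard_selfDual_fixed_sep_eq_of_formCongr` (`M₃ ↦ P₁·M₃`, trivial labels). [cite: Kottwitz1986BaseChangeUnits, §1 pp. 240–241] [cite: Rogawski1990, §4.9 Lemma 4.9.3 p. 56] [cite: Jacobowitz1962, §4] -/
theorem ncard_typeZero_fixed_conj_endoGL_eq_orderForm (L : Type) [Field L] [NumberField L] [IsCMField L]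
    {v : HeightOneSpectrum (𝓞 ↥(maximalRealSubfield L))} (w : UnitaryGroup.PlacesOver L v)
    (hw : IsCMField.complexConj L • w.1 = w.1) {ϖ : (w.1.adicCompletion L)} (hϖ : Valued.v ϖ = WithZero.exp (-1 : ℤ))
    {M : Type*} [Field M] [Valued M ℤᵐ⁰] {ρ Θ : M →+* M} {α : M} (jE : (w.1.adicCompletion L) →+* M)
    (hρρ : ∀ x, ρ (ρ x) = x) (hvρ : ∀ x, Valued.v (ρ x) = Valued.v x) (hα : ρ α ≠ α) (hα1 : Valued.v α ≤ 1)
    (hint : ∀ z : M, Valued.v z ≤ 1 → Valued.v ((z - ρ z) / (α - ρ α)) ≤ 1)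
    (hΘΘ : ∀ x, Θ (Θ x) = x) (hΘρ : ∀ x, Θ (ρ x) = ρ (Θ x)) (hvΘ : ∀ x, Valued.v (Θ x) = Valued.v x)
    (hΘj : ∀ x, Θ (jE x) = jE ((galAdicCompletionMap (L := L) (IsCMField.complexConj L) hw) x))
    (hjv : ∀ c, Valued.v (jE c) ≤ 1 ↔ Valued.v c ≤ 1) (hjfix : ∀ z, ρ z = z ↔ ∃ c, jE c = z)
    (hjpow : ∀ (t : (w.1.adicCompletion L)) (n : ℤ), Valued.v (jE t) = Valued.v (jE ϖ) ^ n ↔ Valued.v t = Valued.v ϖ ^ n)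
    (hEval : ∀ c : M, ρ c = c → c ≠ 0 → Valued.v c ≤ 1 → ∃ n : ℕ, Valued.v c = Valued.v (jE ϖ) ^ n)
    (hϖmax : ∀ t : M, ρ t = t → Valued.v t < 1 → Valued.v t ≤ Valued.v (jE ϖ))
    (P₁ : GL (Fin 3) (w.1.adicCompletion L)) (dg : Fin 2 → (w.1.adicCompletion L)) (η : (w.1.adicCompletion L))
    (γ₁ : GL (Fin 2) (w.1.adicCompletion L)) (u : GL (Fin 1) (w.1.adicCompletion L))
    (hfc : formCongr (galAdicCompletionMap (L := L) (IsCMField.complexConj L) hw) P₁ (placeForm (Matrix.of fun i j : Fin 3 => if i.val + j.val + 1 = 3 then (1 : L) else 0) w.1) =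
      (!![(Matrix.diagonal dg) 0 0, 0, (Matrix.diagonal dg) 0 1; 0, η, 0; (Matrix.diagonal dg) 1 0, 0, (Matrix.diagonal dg) 1 1] : Matrix (Fin 3) (Fin 3) (w.1.adicCompletion L)))
    (hdg1 : ∀ i, Valued.v (dg i) = 1) (hdgσ : ∀ i, (galAdicCompletionMap (L := L) (IsCMField.complexConj L) hw) (dg i) = dg i)
    (hησ : (galAdicCompletionMap (L := L) (IsCMField.complexConj L) hw) η = η) (hη1 : Valued.v η = 1)
    (hmem : P₁ * endoGL (γ₁, u) * P₁⁻¹ ∈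
      unitaryGroupOfForm (galAdicCompletionMap (L := L) (IsCMField.complexConj L) hw) (placeForm (Matrix.of fun i j : Fin 3 => if i.val + j.val + 1 = 3 then (1 : L) else 0) w.1))
    (hu : Valued.v ((u : Matrix (Fin 1) (Fin 1) (w.1.adicCompletion L)) 0 0) = 1)
    (φ : (Fin 2 → (w.1.adicCompletion L)) →+ M) (hφs : ∀ (c : (w.1.adicCompletion L)) (x : Fin 2 → (w.1.adicCompletion L)), φ (c • x) = jE c * φ x)
    (hφi : Function.Injective φ) (hφo : Function.Surjective φ)
    {lam h : M} (hφγ : ∀ x, φ ((γ₁ : Matrix (Fin 2) (Fin 2) (w.1.adicCompletion L)).mulVec x) = lam * φ x) (hlam : Valued.v lam = 1)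
    (hΘh : Θ h = h) (hh : h ≠ 0)
    (hform : ∀ x y, jE (pairing (galAdicCompletionMap (L := L) (IsCMField.complexConj L) hw) (Matrix.diagonal dg) x y) = h * Θ (φ x) * φ y + ρ (h * Θ (φ x) * φ y))
    {R : ℕ}
    (hfinF : {M₃ : Submodule (Valued.integer (w.1.adicCompletion L)) (Fin 3 → (w.1.adicCompletion L)) |
      IsSelfDualLattice (galAdicCompletionMap (L := L) (IsCMField.complexConj L) hw) ϖ
        (!![(Matrix.diagonal dg) 0 0, 0, (Matrix.diagonal dg) 0 1; 0, η, 0; (Matrix.diagonal dg) 1 0, 0, (Matrix.diagonal dg) 1 1] : Matrix (Fin 3) (Fin 3) (w.1.adicCompletion L)) M₃ ∧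
      mapGL (endoGL (γ₁, u)) M₃ = M₃}.Finite)
    (hR : ∀ M₃ : Submodule (Valued.integer (w.1.adicCompletion L)) (Fin 3 → (w.1.adicCompletion L)),
      IsSelfDualLattice (galAdicCompletionMap (L := L) (IsCMField.complexConj L) hw) ϖ
        (!![(Matrix.diagonal dg) 0 0, 0, (Matrix.diagonal dg) 0 1; 0, η, 0; (Matrix.diagonal dg) 1 0, 0, (Matrix.diagonal dg) 1 1] : Matrix (Fin 3) (Fin 3) (w.1.adicCompletion L)) M₃ →
      mapGL (endoGL (γ₁, u)) M₃ = M₃ → ∀ b : ℕ, (∀ c : (w.1.adicCompletion L), (Pi.single 1 c : Fin 3 → (w.1.adicCompletion L)) ∈ M₃ ↔ Valued.v c ≤ Valued.v ϖ ^ b) → b ≤ R)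
    {J : ℕ} (hJ : ¬ IsOrd ρ α (jE ϖ ^ (J + 1)) lam) (hfinLS : ∀ j a, (levelSet ρ Θ α (jE ϖ) h j a).Finite)
    (f : ℕ → ℕ → AddSubgroup M → ℕ)
    (hf : ∀ (b j : ℕ) (Λ : AddSubgroup M) (x₀ : M) (r : (w.1.adicCompletion L)), 1 ≤ b → x₀ ≠ 0 →
      (∀ x, x ∈ Λ ↔ ∃ z, IsOrd ρ α (jE ϖ ^ j) z ∧ x = x₀ * z) →
      IsOrd ρ α (jE ϖ ^ j) (dualGen ρ Θ α (jE ϖ ^ j) h x₀) → ¬ IsOrd ρ α (jE ϖ ^ j) (dualGen ρ Θ α (jE ϖ ^ j) h x₀ / jE ϖ) →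
      Valued.v (dualGen ρ Θ α (jE ϖ ^ j) h x₀) = Valued.v (jE ϖ) ^ b →
      (∀ b', (∀ x ∈ Λ, Valued.v (h * Θ x * b' + ρ (h * Θ x * b')) ≤ 1) → (lam - jE ((u : Matrix (Fin 1) (Fin 1) (w.1.adicCompletion L)) 0 0)) * b' ∈ Λ) →
      IsOrd ρ α (jE ϖ ^ j) lam → jE r = glueUnit ρ Θ α (jE ϖ ^ j) h (jE ϖ) (jE η) x₀ b →
      f b j Λ = Nat.card {x : 𝒪[(w.1.adicCompletion L)] ⧸ 𝓂[(w.1.adicCompletion L)] ^ (2 * b) //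
        ∃ u' : 𝒪[(w.1.adicCompletion L)], Ideal.Quotient.mk (𝓂[(w.1.adicCompletion L)] ^ (2 * b)) u' = x ∧
          Valued.v ((u' : (w.1.adicCompletion L)) * (galAdicCompletionMap (L := L) (IsCMField.complexConj L) hw) u' - r) ≤ Valued.v (ϖ ^ (2 * b))}) :
    {M₃ : Submodule (Valued.integer (w.1.adicCompletion L)) (Fin 3 → (w.1.adicCompletion L)) |
        IsVertexLattice (galAdicCompletionMap (L := L) (IsCMField.complexConj L) hw) ϖ ((StdForm.antidiagonal 3).over (w.1.adicCompletion L)) 0 M₃ ∧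
        mapGL (P₁ * endoGL (γ₁, u) * P₁⁻¹) M₃ = M₃}.ncard =
      (∑ j ∈ Finset.range (J + 1), (if IsOrd ρ α (jE ϖ ^ j) lam then (levelSet ρ Θ α (jE ϖ) h j 0).ncard else 0)) +
        ∑ b ∈ Finset.Icc 1 R, ∑ j ∈ Finset.range (J + 1),
          (if IsOrd ρ α (jE ϖ ^ j) lam then ∑ᶠ Λ ∈ levelSetDep ρ Θ α (jE ϖ) h j b (lam - jE ((u : Matrix (Fin 1) (Fin 1) (w.1.adicCompletion L)) 0 0)), f b j Λ else 0) := by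
  haveI : IsPrincipalIdealRing 𝒪[w.1.adicCompletion L] := isPrincipalIdealRing_integer_adicCompletion L v w
  have hσ : ∀ a, (galAdicCompletionMap (L := L) (IsCMField.complexConj L) hw) ((galAdicCompletionMap (L := L) (IsCMField.complexConj L) hw) a) = a :=
    galAdicCompletionMap_involutive L v w hw
  have hvσ : ∀ a, Valued.v ((galAdicCompletionMap (L := L) (IsCMField.complexConj L) hw) a) = Valued.v a :=
    fun a => valued_galAdicCompletionMap (L := L) (IsCMField.complexConj L) hw a
  -- `diag dg` is hermitian of unit determinant
  have hH₂ : IsUnit (Matrix.diagonal dg).det := by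
    rw [Matrix.det_diagonal]
    refine isUnit_iff_ne_zero.2 (Finset.prod_ne_zero_iff.2 fun i _ h0 => ?_)
    have h1 := hdg1 i
    rw [h0, map_zero] at h1
    exact zero_ne_one h1
  have hH₂σ : ((Matrix.diagonal dg).map (galAdicCompletionMap (L := L) (IsCMField.complexConj L) hw))ᵀ = Matrix.diagonal dg := by
    rw [Matrix.diagonal_map (map_zero _), Matrix.diagonal_transpose]
    exact congrArg Matrix.diagonal (funext hdgσ)
  -- the block element is unitary for the congruent form
  have hΓ : endoGL (γ₁, u) ∈ unitaryGroupOfForm (galAdicCompletionMap (L := L) (IsCMField.complexConj L) hw)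
      (!![(Matrix.diagonal dg) 0 0, 0, (Matrix.diagonal dg) 0 1; 0, η, 0; (Matrix.diagonal dg) 1 0, 0, (Matrix.diagonal dg) 1 1] : Matrix (Fin 3) (Fin 3) (w.1.adicCompletion L)) := by
    rw [← hfc]
    exact (conj_mem_unitaryGroupOfForm_iff (galAdicCompletionMap (L := L) (IsCMField.complexConj L) hw) P₁ _ (endoGL (γ₁, u))).1 hmem
  -- the socket's set is the `H`-side of the count transport along `M₃ ↦ P₁·M₃` (trivial labels); transport it to the congruent form
  have e1 : {M₃ : Submodule (Valued.integer (w.1.adicCompletion L)) (Fin 3 → (w.1.adicCompletion L)) |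
        IsVertexLattice (galAdicCompletionMap (L := L) (IsCMField.complexConj L) hw) ϖ ((StdForm.antidiagonal 3).over (w.1.adicCompletion L)) 0 M₃ ∧
        mapGL (P₁ * endoGL (γ₁, u) * P₁⁻¹) M₃ = M₃} =
      {M₃ : Submodule (Valued.integer (w.1.adicCompletion L)) (Fin 3 → (w.1.adicCompletion L)) |
        IsSelfDualLattice (galAdicCompletionMap (L := L) (IsCMField.complexConj L) hw) ϖ (placeForm (Matrix.of fun i j : Fin 3 => if i.val + j.val + 1 = 3 then (1 : L) else 0) w.1) M₃ ∧
        mapGL (P₁ * endoGL (γ₁, u) * P₁⁻¹) M₃ = M₃ ∧ True} := by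
    ext M₃
    simp only [Set.mem_setOf_eq, and_true, placeForm_antidiagOne]
  have e2 : {M₃ : Submodule (Valued.integer (w.1.adicCompletion L)) (Fin 3 → (w.1.adicCompletion L)) |
        IsSelfDualLattice (galAdicCompletionMap (L := L) (IsCMField.complexConj L) hw) ϖ
          (!![(Matrix.diagonal dg) 0 0, 0, (Matrix.diagonal dg) 0 1; 0, η, 0; (Matrix.diagonal dg) 1 0, 0, (Matrix.diagonal dg) 1 1] : Matrix (Fin 3) (Fin 3) (w.1.adicCompletion L)) M₃ ∧
        mapGL (endoGL (γ₁, u)) M₃ = M₃ ∧ True} =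
      {M₃ : Submodule (Valued.integer (w.1.adicCompletion L)) (Fin 3 → (w.1.adicCompletion L)) |
        IsSelfDualLattice (galAdicCompletionMap (L := L) (IsCMField.complexConj L) hw) ϖ
          (!![(Matrix.diagonal dg) 0 0, 0, (Matrix.diagonal dg) 0 1; 0, η, 0; (Matrix.diagonal dg) 1 0, 0, (Matrix.diagonal dg) 1 1] : Matrix (Fin 3) (Fin 3) (w.1.adicCompletion L)) M₃ ∧
        mapGL (endoGL (γ₁, u)) M₃ = M₃} := by
    ext M₃
    simp only [Set.mem_setOf_eq, and_true]
  rw [e1, ncard_selfDual_fixed_sep_eq_of_formCongr (galAdicCompletionMap (L := L) (IsCMField.complexConj L) hw) ϖ _ P₁ (endoGL (γ₁, u))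
    (fun _ => True) (fun _ => True) (fun _ => Iff.rfl), hfc, e2]
  exact ncard_fixed_selfDual_endoGL_eq_orderForm (galAdicCompletionMap (L := L) (IsCMField.complexConj L) hw) hσ hvσ hϖ hH₂ hH₂σ hη1 hησ jE hρρ hvρ hα hα1 hint
    hΘΘ hΘρ hvΘ hΘj hjv hjfix hjpow hEval hϖmax φ hφs hφi hφo hφγ hlam hΘh hh hform u hΓ hu hfinF hR hJ hfinLS f hf

end Summit.HodgeConjecture.HodgeConjecture.Cruxes.H413.F0P3cDyRamBlockCensusOrderFormCM

end
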